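import Mathlib.RepresentationTheory.Coinvariants
import Mathlib.LinearAlgebra.Charpoly.ToMatrix
import Mathlib.LinearAlgebra.Matrix.Charpoly.Coeff
import Mathlib.Algebra.Polynomial.Expand
import Literature.RepresentationTheory.Semisimple.Twist
import HarnessLib

/-!
# Coinvariants of a representation twisted by a quadratic character (local Artin formalism, I)

Topic `NumberTheory/GaloisRepresentations`.  Pure representation theory behind the *local* form
of Artin formalism for a quadratic base change, as it is used for the Hasse–Weil Euler factors
`L_v(V, T) = det(1 - Frob T ∣ V_{I_v})` (inertia **co**invariants, arithmetic Frobenius; Serre,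
*Facteurs locaux des fonctions zêta*, Sém. DPP 1969/70, §2.3, §4.1) of an `ℓ`-adic representation
`V` of `Γ_ℚ`, its restriction to `Γ_K` (`K/ℚ` quadratic, character `χ`) and its twist `V ⊗ χ`:
`L_w(V|_{Γ_K}, T^{f})` against `L_v(V, T) · L_v(V ⊗ χ, T)` (Ireland–Rosen, *A Classical
Introduction to Modern Number Theory*, Prop. 20.5.4(b), for `V = V_ℓ E`).  For a representation
`ρ` of a group `G` on a `k`-vector space `V`, a subgroup `J ≤ G` and a character `χ : G → kˣ`
(the twist `ρ ⊗ χ : g ↦ χ(g) ρ(g)` is the tree's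
`Literature.RepresentationTheory.Semisimple.Representation.twist`, file
`RepresentationTheory/Semisimple/Twist`):

* `ker_comp_subtype_mono`, `ker_twist_comp_subtype_eq` — the kernels
  `⟨ρ(j)v - v ∣ j ∈ J⟩` defining the coinvariants `V_J` (Mathlib `Representation.Coinvariants.ker`
  of `ρ|_J`) are monotone in `J` and unchanged by a twist trivial on `J`;
* `ker_comp_subtype_eq_sup_range`, `ker_twist_comp_subtype_eq_sup_range` — if `I = J ∪ Jτ`
  (`τ ∈ I`) then `ker_I = ker_J + (ρ τ - 1)V` and, for `χ = 1` on `J`, `χ τ = -1`,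
  `ker_I(ρ ⊗ χ) = ker_J + (ρ τ + 1)V` — the two quotients of `V_J` appearing at a ramified prime;
* `charpoly_toCoinvariants_twist` — **unramified twist**: if `χ = 1` on the normal subgroup `J`,
  `g` acts on `(V ⊗ χ)_J = V_J` as `χ(g)` times its action on `V_J` (so the Euler factor of the
  twist is `L(V, χ(Frob) T)`);
* `expand_two_reverse_charpoly_mul_self` — **inert primes**:
  `det(1 - F² T²) = det(1 - F T) · det(1 + F T)`, i.e.
  `expand 2 (rev charpoly F²) = rev charpoly F · rev charpoly (-F)` (Frobenius upstairs is the
  square of Frobenius downstairs and `χ(Frob) = -1`).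

The ramified case (the characteristic polynomial on `V_{I ∩ ker χ}` is the product of those on
`V_I` and `(V ⊗ χ)_I`) is the sibling file `CoinvariantsQuadraticTwistRamified`.  Everything is
proved; there are no definitions.

## References

* K. Ireland, M. Rosen, *A Classical Introduction to Modern Number Theory*, 2nd ed., GTM 84
  (1990), Ch. 20 §5, Prop. 20.5.4(b). [IrelandRosen1990]
* J.-P. Serre, *Facteurs locaux des fonctions zêta des variétés algébriques*, Sém.
  Delange–Pisot–Poitou 1969/70, exp. 19, §2.3, §4.1; J. Neukirch, *Algebraic Number Theory*
  (1999), VII §10, (10.4) and its proof. [NeukirchANT1999]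

## Design

The twist is imported from `Literature/RepresentationTheory/Semisimple/Twist.lean`
(`Literature.RepresentationTheory.Semisimple.Representation.twist ρ χ`, `g ↦ (χ g : k) • ρ g`,
over a field `k`; the tree also has the `CommRing` copy `_root_.Representation.twist` in
`NumberTheory/Automorphic/MatrixCoefficients` and `twistRep` in
`AlgebraicGeometry/Motives/GaloisRealization`, neither of which is needed here).  Coinvariants are
Mathlib's `Representation.Coinvariants (ρ.comp J.subtype)` with the `G`-action
`Representation.toCoinvariants` for normal `J`, exactly as in the tree's
`ContinuousRep.InertiaCoinvariants` (`EllipticCurves/HasseWeilAbelian`), to which these lemmas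
are applied with `G` a decomposition group and `J` its inertia subgroup.
-/

noncomputable section

open Polynomial Literature.RepresentationTheory.Semisimple

namespace Literature.NumberTheory.GaloisRepresentations

universe u v w

/-! ### The kernels defining the coinvariants `V_J` and of a twist -/

section Twist

variable {k : Type u} [Field k] {G : Type v} [Group G] {V : Type w} [AddCommGroup V]
  [Module k V]

/-- `ρ|_J (j) = ρ(j)` for `j ∈ J` (Mathlib `MonoidHom.comp` with `Subgroup.subtype`). [folklore] -/
@[simp] theorem comp_subtype_apply (ρ : Representation k G V) (J : Subgroup G) (j : J) :
    ρ.comp J.subtype j = ρ (j : G) := rfl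

/-- The kernel `⟨ρ(j) v - v ∣ j ∈ J, v ∈ V⟩` of `V → V_J` is monotone in the subgroup `J`.
[folklore] -/
theorem ker_comp_subtype_mono (ρ : Representation k G V) {J J' : Subgroup G} (h : J ≤ J') :
    Representation.Coinvariants.ker (ρ.comp J.subtype) ≤
      Representation.Coinvariants.ker (ρ.comp J'.subtype) := by
  refine Submodule.span_le.2 ?_
  rintro _ ⟨⟨j, x⟩, rfl⟩
  exact Representation.Coinvariants.mem_ker_of_eq (ρ := ρ.comp J'.subtype) ⟨j, h j.2⟩ x _ rfl

/-- `ρ(j) v - v` lies in the kernel of `V → V_J` for `j ∈ J` (membership form of Mathlib's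
`Coinvariants.sub_mem_ker`). [folklore] -/
theorem sub_mem_ker_comp_subtype (ρ : Representation k G V) {J : Subgroup G} {j : G} (hj : j ∈ J)
    (x : V) : ρ j x - x ∈ Representation.Coinvariants.ker (ρ.comp J.subtype) :=
  Representation.Coinvariants.mem_ker_of_eq (ρ := ρ.comp J.subtype) ⟨j, hj⟩ x _ rfl

/-- A twist trivial on `J` does not change the kernel of `V → V_J`:
`⟨χ(j)ρ(j)v - v⟩ = ⟨ρ(j)v - v⟩` when `χ = 1` on `J`. [folklore] -/
theorem ker_twist_comp_subtype_eq (ρ : Representation k G V) (χ : G →* kˣ) {J : Subgroup G}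
    (hχ : ∀ j ∈ J, χ j = 1) :
    Representation.Coinvariants.ker ((Representation.twist ρ χ).comp J.subtype) =
      Representation.Coinvariants.ker (ρ.comp J.subtype) := by
  unfold Representation.Coinvariants.ker
  congr 1
  ext x
  simp only [Set.mem_range, Prod.exists, comp_subtype_apply, Representation.twist_apply,
    LinearMap.smul_apply]
  constructor
  · rintro ⟨j, v, rfl⟩
    exact ⟨j, v, by rw [hχ j j.2, Units.val_one, one_smul]⟩
  · rintro ⟨j, v, rfl⟩
    exact ⟨j, v, by rw [hχ j j.2, Units.val_one, one_smul]⟩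

/-- **`ker_I = ker_J + (ρ τ - 1) V` when `I = J ∪ J τ`.**  For subgroups `J ≤ I` and `τ ∈ I`
such that every `i ∈ I` lies in `J` or in `J τ`, the kernel of `V → V_I` is generated by the
kernel of `V → V_J` and the image of `ρ(τ) - 1`
(`ρ(jτ)v - v = (ρ(j)(ρ τ v) - ρ τ v) + (ρ τ v - v)`).  With `I` an inertia group and `J` its
index-two subgroup cut out by a ramified quadratic character this exhibits `V_I` as the quotient of
`V_J` by `(τ - 1)V_J`. [folklore] -/
theorem ker_comp_subtype_eq_sup_range (ρ : Representation k G V) {I J : Subgroup G} (hJI : J ≤ I)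
    {τ : G} (hτ : τ ∈ I) (hI : ∀ i ∈ I, i ∈ J ∨ i * τ⁻¹ ∈ J) :
    Representation.Coinvariants.ker (ρ.comp I.subtype) =
      Representation.Coinvariants.ker (ρ.comp J.subtype) ⊔ LinearMap.range (ρ τ - 1) := by
  refine le_antisymm ?_ (sup_le (ker_comp_subtype_mono ρ hJI) ?_)
  · refine Submodule.span_le.2 ?_
    rintro _ ⟨⟨i, x⟩, rfl⟩
    simp only [comp_subtype_apply, SetLike.mem_coe]
    rcases hI i i.2 with hi | hi
    · exact Submodule.mem_sup_left (sub_mem_ker_comp_subtype ρ hi x)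
    · have hdec : ρ (i : G) x - x =
          (ρ ((i : G) * τ⁻¹) (ρ τ x) - ρ τ x) + (ρ τ x - x) := by
        rw [← Module.End.mul_apply, ← map_mul, inv_mul_cancel_right, sub_add_sub_cancel]
      rw [hdec]
      exact Submodule.add_mem_sup (sub_mem_ker_comp_subtype ρ hi _)
        ⟨x, by simp [LinearMap.sub_apply]⟩
  · rintro _ ⟨x, rfl⟩
    simpa [LinearMap.sub_apply] using sub_mem_ker_comp_subtype ρ hτ x

/-- **`ker_I(ρ ⊗ χ) = ker_J + (ρ τ + 1) V`** in the same situation, for a character `χ` trivial on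
`J` with `χ(τ) = -1` (a *ramified* quadratic character): `(V ⊗ χ)_I` is the quotient of `V_J` by
`(τ + 1)V_J`. [folklore] -/
theorem ker_twist_comp_subtype_eq_sup_range (ρ : Representation k G V) (χ : G →* kˣ)
    {I J : Subgroup G} (hJI : J ≤ I) {τ : G} (hτ : τ ∈ I) (hI : ∀ i ∈ I, i ∈ J ∨ i * τ⁻¹ ∈ J)
    (hχJ : ∀ j ∈ J, χ j = 1) (hχτ : χ τ = -1) :
    Representation.Coinvariants.ker ((Representation.twist ρ χ).comp I.subtype) =
      Representation.Coinvariants.ker (ρ.comp J.subtype) ⊔ LinearMap.range (ρ τ + 1) := by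
  rw [ker_comp_subtype_eq_sup_range (Representation.twist ρ χ) hJI hτ hI,
    ker_twist_comp_subtype_eq ρ χ hχJ]
  congr 1
  have h : Representation.twist ρ χ τ - 1 = -(ρ τ + 1) := by
    rw [Representation.twist_apply, hχτ, Units.val_neg, Units.val_one, neg_smul, one_smul]
    abel
  rw [h, LinearMap.range_neg]

/-! ### Elements acting trivially on coinvariants -/

/-- An element of the normal subgroup `S` acts trivially on the coinvariants `V_S` (Mathlib's
`IsTrivial ((toCoinvariants ρ S).comp S.subtype)`, membership form). [folklore] -/
theorem toCoinvariants_eq_one_of_mem (ρ : Representation k G V) (S : Subgroup G) [S.Normal]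
    {g : G} (hg : g ∈ S) : ρ.toCoinvariants S g = 1 := by
  refine Representation.Coinvariants.hom_ext (LinearMap.ext fun x => ?_)
  simp only [LinearMap.comp_apply]
  change Representation.Coinvariants.mk _ (ρ g x) = Representation.Coinvariants.mk _ x
  exact (Representation.Coinvariants.mk_eq_iff _).2 (sub_mem_ker_comp_subtype ρ hg x)

/-- Two elements congruent modulo `S` act identically on `V_S`: in particular every arithmetic
Frobenius at `𝔓` acts in the same way on the inertia coinvariants `V_{I_𝔓}`, and so does
`Frob^f` for an element congruent to it modulo `I_𝔓`. [folklore] -/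
theorem toCoinvariants_eq_of_mul_inv_mem (ρ : Representation k G V) (S : Subgroup G) [S.Normal]
    {g h : G} (hgh : g * h⁻¹ ∈ S) : ρ.toCoinvariants S g = ρ.toCoinvariants S h := by
  have hg : g = (g * h⁻¹) * h := by group
  rw [hg, map_mul, toCoinvariants_eq_one_of_mem ρ S hgh, one_mul]

end Twist

/-! ### Characteristic polynomials: transport, unramified twists, squares -/

section Charpoly

variable {k : Type u} [Field k]

/-- Two endomorphisms intertwined by a linear isomorphism have the same characteristic polynomial
(Mathlib `LinearEquiv.charpoly_conj`, stated with the intertwining relation as hypothesis).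
[folklore] -/
theorem charpoly_eq_of_semiconj {M₁ : Type v} {M₂ : Type w} [AddCommGroup M₁] [Module k M₁]
    [AddCommGroup M₂] [Module k M₂] [Module.Finite k M₁] [Module.Finite k M₂]
    (e : M₁ ≃ₗ[k] M₂) {f₁ : Module.End k M₁} {f₂ : Module.End k M₂}
    (h : ∀ x, e (f₁ x) = f₂ (e x)) : f₁.charpoly = f₂.charpoly := by
  have he : e.conj f₁ = f₂ := by
    refine LinearMap.ext fun y => ?_
    rw [LinearEquiv.conj_apply_apply, h, LinearEquiv.apply_symm_apply]
  rw [← he, LinearEquiv.charpoly_conj]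

variable {G : Type v} [Group G] {V : Type w} [AddCommGroup V] [Module k V] [Module.Finite k V]

/-- The characteristic polynomial on `V_S` only depends on the subgroup `S` (transport along an
equality of subgroups, e.g. `I ⊓ ker χ = I` for a character unramified at `I`). [folklore] -/
theorem charpoly_toCoinvariants_congr (ρ : Representation k G V) {S S' : Subgroup G} [S.Normal]
    [S'.Normal] (h : S = S') (g : G) :
    (ρ.toCoinvariants S g).charpoly = (ρ.toCoinvariants S' g).charpoly := by
  subst h
  rfl

/-- **Unramified twists.**  If the character `χ` is trivial on the normal subgroup `J` (an
inertia group acting through an unramified quadratic extension), then for every `g ∈ G` the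
action of `g` on the coinvariants `(V ⊗ χ)_J` has the same characteristic polynomial as `χ(g)`
times the action of `g` on `V_J`; hence `L(V ⊗ χ, T) = L(V, χ(Frob) T)` at such a place
(Neukirch, *Algebraic Number Theory*, VII §10; Ireland–Rosen Prop. 20.5.4(b), unramified primes).
[folklore] -/
theorem charpoly_toCoinvariants_twist (ρ : Representation k G V) (χ : G →* kˣ) (J : Subgroup G)
    [J.Normal] (hχ : ∀ j ∈ J, χ j = 1) (g : G) :
    ((Representation.twist ρ χ).toCoinvariants J g).charpoly =
      ((χ g : k) • ρ.toCoinvariants J g).charpoly := by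
  refine charpoly_eq_of_semiconj (Submodule.quotEquivOfEq _ _ (ker_twist_comp_subtype_eq ρ χ hχ))
    fun x => ?_
  induction x using Submodule.Quotient.induction_on with
  | H v =>
    change Submodule.quotEquivOfEq _ _ _
        (Representation.Coinvariants.mk _ (Representation.twist ρ χ g v)) =
      ((χ g : k) • ρ.toCoinvariants J g) (Submodule.quotEquivOfEq _ _ _ (Submodule.Quotient.mk v))
    rw [Submodule.quotEquivOfEq_mk, LinearMap.smul_apply]
    change _ = (χ g : k) • Representation.Coinvariants.mk _ (ρ g v)
    rw [Representation.twist_apply, LinearMap.smul_apply, map_smul]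
    rfl

/-- **`det(1 - F²T²) = det(1 - FT) det(1 + FT)`**: for an endomorphism `F` of a finite-dimensional
vector space, `expand 2` of the reversed characteristic polynomial of `F²` is the product of the
reversed characteristic polynomials of `F` and of `-F`.  This is the identity behind the Euler
factor at an *inert* prime of a quadratic extension (`Frob_w = Frob_v²`, `N w = (N v)²`,
`χ(Frob_v) = -1`): `L_w(V, T²)⁻¹… = L_v(V, T) L_v(V ⊗ χ, T)` (Ireland–Rosen Prop. 20.5.4(b);
Neukirch VII (10.4) (iv), inert case).  Proof via Mathlib's `Matrix.reverse_charpoly`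
(`rev charpoly M = det(1 - X • M)`) and `(1 - X²M²) = (1 - XM)(1 + XM)`. [folklore] -/
theorem expand_two_reverse_charpoly_mul_self (F : Module.End k V) :
    expand k 2 (F * F).charpoly.reverse = F.charpoly.reverse * (-F).charpoly.reverse := by
  classical
  set b := Module.Free.chooseBasis k V
  set M : Matrix _ _ k := LinearMap.toMatrix b b F with hM
  have hF : F.charpoly = M.charpoly := (LinearMap.charpoly_toMatrix F b).symm
  have hFF : (F * F).charpoly = (M * M).charpoly := by
    rw [← LinearMap.charpoly_toMatrix (F * F) b, LinearMap.toMatrix_mul, ← hM]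
  have hnF : (-F).charpoly = (-M).charpoly := by
    rw [← LinearMap.charpoly_toMatrix (-F) b, map_neg, ← hM]
  rw [hF, hFF, hnF]
  simp only [Matrix.reverse_charpoly, Matrix.charpolyRev]
  set A : Matrix _ _ k[X] := M.map C with hA
  have hAA : (M * M).map C = A * A := by rw [hA, Matrix.map_mul]
  have hnA : (-M).map (C : k → k[X]) = -A := by
    rw [hA]
    ext i j
    simp [Matrix.map_apply]
  rw [hAA, hnA, AlgHom.map_det, ← Matrix.det_mul]
  congr 1
  -- `expand 2 (1 - X • A²) = 1 - X² • A² = (1 - X • A) * (1 + X • A)`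
  have hexp : (expand k 2 : k[X] →ₐ[k] k[X]).mapMatrix (1 - (X : k[X]) • (A * A)) =
      1 - ((X : k[X]) * X) • (A * A) := by
    rw [map_sub, map_one]
    congr 1
    ext i j
    simp only [AlgHom.mapMatrix_apply, Matrix.map_apply, Matrix.smul_apply, smul_eq_mul,
      map_mul, expand_X, hA, Matrix.mul_apply, map_sum, expand_C, pow_two]
  have key : (1 - (X : k[X]) • A) * (1 + (X : k[X]) • A) = 1 - ((X : k[X]) * X) • (A * A) := by
    rw [sub_mul, one_mul, mul_add, mul_one, smul_mul_smul_comm]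
    abel
  rw [hexp, smul_neg, sub_neg_eq_add, key]

end Charpoly

end Literature.NumberTheory.GaloisRepresentations
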